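import Summits.BirchSwinnertonDyer.BirchSwinnertonDyer.Theorems.ThetaPartnerAtTwoSignedControlAtTwoShaThreeBaseChooseE
import Summits.BirchSwinnertonDyer.BirchSwinnertonDyer.Theorems.ThetaPartnerAtTwoSignedControlAtTwoShaThreeBaseKillT
import Summits.BirchSwinnertonDyer.BirchSwinnertonDyer.Theorems.ThetaPartnerAtTwoSignedControlAtTwoGlobalHTwoFiniteSupport
import Summits.BirchSwinnertonDyer.BirchSwinnertonDyer.Theorems.ThetaPartnerAtTwoSignedControlAtTwoShaThreeBaseNormAssembly
import HarnessLib

/-!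
# K4 `SignedControlAtTwo`, base case of Milne I 4.10 (c)₃: every real-trivial class of `H²(F, T)` dies on `Γ_{F(√e)}` for some
# totally positive non-square `e` (the binder (hDie) of the (NORM_T) road, discharged)

Route `ThetaPartnerAtTwo` (TP2), crux K4 `SignedControlAtTwo` (stmt-BirchSwinnertonDyer-20309), line `eulerchar` v15, stub
`stub_realThreeOrderTwoBase`; width seat `bsd-wall-tp2-p3-w2` gen 7 (`--supports stmt-BirchSwinnertonDyer-20309`, helper).
Last wiring step of the (NORM_T) road `Cruxes/SignedControlAtTwo/HBASE-ROAD-w2g7.md` (an independent, class-formation-light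
proof of the base case; the stub itself was meanwhile closed by w3 g9's `…ShaThreeBaseH3Units` via Tate's `H³(F, 𝔾_m) = 0`):

* **`exists_dies_on_quadratic`** — for a number field `F`, a discrete `Γ_F`-module `T` with trivial action and `Nat.card T = 2`
  (finite), and `y ∈ H²(F, T)` vanishing at every real place, there are `e ∈ F`, `ε ∈ F̄` with `ε² = e`, `e` positive under
  every real embedding, `ε ∉ F`, and `res_{Γ_{F(ε)}} y = 0`: finite support `S` of `y` (k4-p1's
  `H2FiniteSupport.exists_finset_forall_localization_two_eq_zero`), the CRT element of brick B3
  (`…ShaThreeBaseChooseE.exists_totallyPositive_forall_two_dvd_localIndex`: `e ≫ 0` non-square with even local index of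
  `Γ_{F(ε)}` at every `v ∈ S`), and the killing of brick B2 in `T`-currency (`…ShaThreeBaseKillT.resH_eq_zero_of_dvd_localIndex`).
  This is exactly the hypothesis (hDie) of w5's `…ShaThreeBaseNormAssembly.stub_realThreeOrderTwoBase_of_dies`.
* **`stub_realThreeOrderTwoBase_normT`** — the registered stub `stub_realThreeOrderTwoBase` (= the binder `hbase` of
  `…ShaThree.poitouTate_three_realPlaces_injective_of_devissage`) with its VERBATIM signature and NO binder left, by the (NORM_T)
  road: `stub_realThreeOrderTwoBase_of_dies exists_dies_on_quadratic`.  A second, independent proof of the base case (the first,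
  `…ShaThreeBrauer.stub_realThreeOrderTwoBase`, goes through `H³(F, 𝔾_m) = 0`); this one uses only Brauer–Hasse–Noether at level
  `2`, Shapiro, cor/transfer and `cd₂ ≤ 2` of totally imaginary number fields.

HONEST FRAMING: THEOREMS ONLY (no definition, no named fact, no `sorry`); closes no item; BSD is not proved by any of this.
References: [MilneADT2006] I Thm. 4.10 (c), Lemma 4.8; [SerreGaloisCohomology1997] II §4.4 Prop. 13; [NeukirchANT1999] II §3 (3.4).
-/

set_option autoImplicit false
-- the Theorems namespace of this sub repeats the summit name by design (D-0017 nested layout)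
set_option linter.dupNamespace false

noncomputable section

open CategoryTheory Function Field NumberField IsDedekindDomain
open scoped NumberField
open _root_.TopRep _root_.ContRepresentation _root_.ContinuousCohomology
open Literature.NumberTheory.GaloisRepresentations
open Literature.NumberTheory.GaloisRepresentations.LocalWeilDatum

namespace Summit.BirchSwinnertonDyer.BirchSwinnertonDyer.Theorems.SignedEC.ShaThreeBase

variable {F : Type} [Field F] [NumberField F]
variable {T : Type} [AddCommGroup T] [TopologicalSpace T] [DiscreteTopology T]

/-- **(hDie): every real-trivial class of `H²(F, T)` dies on `Γ_{F(√e)}` for some totally positive non-square `e`**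
(`T` with trivial `Γ_F`-action and `Nat.card T = 2`). [cite: MilneADT2006, Ch. I, Thm. 4.10 (c) and Lemma 4.8]
[cite: SerreGaloisCohomology1997, II §4.4 Prop. 13] -/
theorem exists_dies_on_quadratic [Finite T] (σT : DiscreteGaloisModule F T)
    (htriv : ∀ (x : absoluteGaloisGroup F) (t : T), σT x t = t) (hT : Nat.card T = 2)
    (y : galoisCohomology σT 2)
    (hreal : ∀ w : InfinitePlace F, w.IsReal → galoisCohomology.localization σT (Sum.inl w) 2 y = 0) :
    ∃ (e : F) (ε : AlgebraicClosure F), ε * ε = algebraMap F _ e ∧ (∀ φ : F →+* ℝ, 0 < φ e) ∧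
      ε ∉ (algebraMap F (AlgebraicClosure F)).range ∧
      resH (galFixing F (IntermediateField.adjoin F {ε})) σT 2 y = 0 := by
  classical
  obtain ⟨S, hS⟩ := H2FiniteSupport.exists_finset_forall_localization_two_eq_zero σT y
  obtain ⟨e, ε, hε, hpos, hεF, hbad⟩ := exists_totallyPositive_forall_two_dvd_localIndex (F := F) S
  refine ⟨e, ε, hε, hpos, hεF, ?_⟩
  haveI : FiniteDimensional F (IntermediateField.adjoin F {ε}) :=
    IntermediateField.adjoin.finiteDimensional (isIntegral_of_sq (F := F) ε)
  haveI : (galFixing F (IntermediateField.adjoin F {ε})).Normal :=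
    Subgroup.normal_of_index_eq_two (index_galFixing_adjoin_eq_two e ε hε hεF)
  exact resH_eq_zero_of_dvd_localIndex σT htriv hT (IntermediateField.adjoin F {ε}) y S hS hbad hreal

/-- **`stub_realThreeOrderTwoBase` (skeleton `Lines/eulerchar.lean` v15, VERBATIM signature, no binder) by the (NORM_T) road**:
for every number field `F` and every discrete `Γ_F`-module `T` of order `2` with trivial action, a class of `H³(F, T)` vanishing
at every real place is `0` — `stub_realThreeOrderTwoBase_of_dies` fed with `exists_dies_on_quadratic`.  Independent of the
`H³(F, 𝔾_m) = 0` proof `…ShaThreeBrauer.stub_realThreeOrderTwoBase`. [cite: MilneADT2006, Ch. I, Thm. 4.10 (c)]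
[cite: SerreGaloisCohomology1997, II §4.4 Prop. 13] -/
theorem stub_realThreeOrderTwoBase_normT :
    ∀ (F : Type) [Field F] [NumberField F] (T : Type) [AddCommGroup T] [TopologicalSpace T]
      [DiscreteTopology T] [Finite T] (σ : DiscreteGaloisModule F T),
      (∀ (g : absoluteGaloisGroup F) (t : T), σ g t = t) → Nat.card T = 2 →
        ∀ c : galoisCohomology σ 3,
          (∀ w : InfinitePlace F, w.IsReal → galoisCohomology.localization σ (Sum.inl w) 3 c = 0) → c = 0 :=
  stub_realThreeOrderTwoBase_of_dies
    (fun _F _ _ _T _ _ _ _ σ htriv hT y hy => exists_dies_on_quadratic σ htriv hT y hy)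

end Summit.BirchSwinnertonDyer.BirchSwinnertonDyer.Theorems.SignedEC.ShaThreeBase

end
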